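import Summits.QuantumFields.YangMills.Theorems.RecentredCoverTransferCellTranslation
import Summits.QuantumFields.YangMills.Theorems.LangevinControlUVOSLegsFromFemtoAndGapStubAssemblyLatticeSums
import Summits.QuantumFields.YangMills.Theorems.LangevinControlUVOSLegsFromFemtoAndGapStubAssemblyUniformBoundPrep
import HarnessLib

/-!
# `CoverRecentring` for `n = 2` from the scalar MEAN-SHIFT statement `Δ_k = o(a_k⁴)`
# (kit for crux `CoverRecentring`, route `RecentredCoverTransfer`, stmt-QuantumFields-23105, LINE g9-A of planner ym-idea-1 g9)

Helper file (`--supports stmt-QuantumFields-23105 --as helper`; width seat `ym-line-sfw-p2-w3` g28 of cell ym-idea-1, free hands).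
Route-independent, definition-free, 0 sorry.  The route thesis says: «for `n = 2` `CoverRecentring` is EXACTLY the scalar statement
`Δ_k := m_T(k) − m_C(k) = o(a_k⁴)`, since the recentring difference is `−Δ_k²·Σ_{x,y} F(a_k x, a_k y)`», and plans
«`CoverRecentring ⇐ MeanShiftSubQuartic (Δ_k/a_k⁴ → 0) → …`».  This file proves the `n = 2` half of that plan as a theorem:

* §1 `pow_mul_sum_norm_le` — the `a`-UNIFORM Riemann-sum bound `a^(4n)·Σ_{x ∈ sⁿ} ‖F(a x)‖ ≤ 2^(6n)·S_{6n}(F)·Kⁿ` for every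
  Schwartz `F`, every finite `s ⊆ ℤ⁴` and `0 < a ≤ 1` (Schwartz decay + the tree's `sum_prod_decay_le`);
* §2 ★ `tendsto_dist_two_recentre_of_meanShift` — for ANY cells `C_k`, spacings `a_k → 0⁺`, couplings `β_k`, bounded measurable
  observable `O` and comparison centrings `m_k`: if `a_k⁻⁴·(m_{C_k}(O) − m_k) → 0` then
  `dist_{C_k}(a_k·; m_{C_k}) F − dist_{C_k}(a_k·; m_k) F → 0` for EVERY Schwartz `F` on `(ℝ⁴)²` (no off-diagonality, no support
  condition) — by the `n = 2` identity `dist_two_sub_dist_two` of `Theorems/RecentredCoverTransferCellTranslation` the difference is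
  `−(m_C − m)²·Σ_{x∈reps²} F(a x)`, of norm `≤ (a⁻⁴(m_C − m))² · a⁸Σ‖F(a x)‖ ≤ (a⁻⁴(m_C − m))²·const`;
* §3 ★ `coverRecentring_two_of_meanShiftSubQuartic` — the same in the binders of the route (curvature species `r.curvature`, scheme
  `sch`, torus mean `wilsonTorusMean`): `a_k⁻⁴·(m_{C_k} − m_{T_k}) → 0 ⟹` the `n = 2` clause of `CoverRecentring` for every `F`.

HONEST FRAMING: `MeanShiftSubQuartic` itself (finite-size insensitivity of the energy density at physical precision) is NOT proved
and not even filed; the cruxes `CoverRecentring` (23105) / `CommonCentredCoverTransfer` (23106) stay OPEN; no item is closed; no summit,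
rung (R2d ROT is a RECORD rung) or mass gap is proved.  References: Glimm–Jaffe (1987) §6.1; Montvay–Münster (1994) p. 161 (finite-size
laws).
-/

set_option autoImplicit false

noncomputable section

open scoped SchwartzMap BigOperators ENNReal
open MeasureTheory Filter Topology
open Literature.MathematicalPhysics.QuantumFieldTheory Literature.MathematicalPhysics.QuantumLattice
open Literature.MathematicalPhysics.AQFT
open Literature.Probability.LatticeModels (Site)
open Summit.QuantumFields.YangMills.Theorems.ROT (PeriodCell)
open Summit.QuantumFields.YangMills.Theorems.OSLegsFromFemtoAndGap
  (sum_prod_decay_le mul_norm_le_norm_smul_siteToE inv_one_add_norm_pow_le_prod)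

namespace Summit.QuantumFields.YangMills.Theorems.RecentredCoverTransfer

/-! ## §1 The `a`-uniform Riemann-sum bound for a Schwartz function -/

/-- Schwartz decay in product form: `a^(4n)·‖F(a x)‖ ≤ 2^(6n)·S·∏ᵢ a⁴(1 + a‖xᵢ‖)⁻⁶` with `S` the sup of the Schwartz seminorms of
order `≤ (6n, 0)`. [folklore] -/
theorem pow_mul_norm_apply_le {n : ℕ} (F : 𝓢((Fin n → (EuclideanSpace ℝ (Fin 4))), ℂ)) {a : ℝ} (ha : 0 < a) (x : Fin n → Site 4) :
    a ^ (4 * n) * ‖F (fun i => a • siteToE (x i))‖ ≤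
      2 ^ (6 * n) * (Finset.Iic (6 * n, 0)).sup (fun m => SchwartzMap.seminorm ℂ m.1 m.2) F *
        ∏ i, (a ^ 4 * ((1 + a * ‖x i‖) ^ 6)⁻¹) := by
  set y : Fin n → (EuclideanSpace ℝ (Fin 4)) := fun i => a • siteToE (x i) with hy
  set S : ℝ := (Finset.Iic (6 * n, 0)).sup (fun m => SchwartzMap.seminorm ℂ m.1 m.2) F with hS
  -- Schwartz decay `(1 + ‖y‖)^(6n) ‖F y‖ ≤ 2^(6n) S`
  have hdec : (1 + ‖y‖) ^ (6 * n) * ‖F y‖ ≤ 2 ^ (6 * n) * S := by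
    have h := SchwartzMap.one_add_le_sup_seminorm_apply (𝕜 := ℂ) (m := (6 * n, 0)) (k := 6 * n) (n := 0) le_rfl le_rfl F y
    rwa [norm_iteratedFDeriv_zero] at h
  have hpos : 0 < (1 + ‖y‖) ^ (6 * n) := by positivity
  have hFy : ‖F y‖ ≤ 2 ^ (6 * n) * S * ((1 + ‖y‖) ^ (6 * n))⁻¹ := by
    rw [← div_eq_mul_inv, le_div_iff₀ hpos, mul_comm]
    exact hdec
  -- `(1 + ‖y‖)^(−6n) ≤ ∏ᵢ (1 + a‖xᵢ‖)^(−6)`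
  have hprod : ((1 + ‖y‖) ^ (6 * n))⁻¹ ≤ ∏ i, ((1 + a * ‖x i‖) ^ 6)⁻¹ := by
    have h := inv_one_add_norm_pow_le_prod ha.le x y (fun i => mul_norm_le_norm_smul_siteToE ha.le (x i)) 6
    rwa [inv_pow, ← pow_mul] at h
  have hS0 : 0 ≤ S := apply_nonneg _ _
  calc a ^ (4 * n) * ‖F y‖
      ≤ a ^ (4 * n) * (2 ^ (6 * n) * S * ∏ i, ((1 + a * ‖x i‖) ^ 6)⁻¹) := by
        refine mul_le_mul_of_nonneg_left (hFy.trans ?_) (by positivity)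
        exact mul_le_mul_of_nonneg_left hprod (by positivity)
    _ = 2 ^ (6 * n) * S * ∏ i, (a ^ 4 * ((1 + a * ‖x i‖) ^ 6)⁻¹) := by
        rw [Finset.prod_mul_distrib, Finset.prod_const, Finset.card_univ, Fintype.card_fin, ← pow_mul]
        ring

/-- ★ **`a`-uniform Riemann-sum bound**: `a^(4n)·Σ_{x ∈ sⁿ} ‖F(a x)‖ ≤ 2^(6n)·S_{(6n,0)}(F)·(81 Σₘ (m+1)⁻²)ⁿ` for every Schwartz `F`,
every finite `s ⊆ ℤ⁴` and every `0 < a ≤ 1`. [folklore] -/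
theorem pow_mul_sum_norm_le {n : ℕ} (F : 𝓢((Fin n → (EuclideanSpace ℝ (Fin 4))), ℂ)) {a : ℝ} (ha : 0 < a) (ha1 : a ≤ 1) (s : Finset (Site 4)) :
    a ^ (4 * n) * ∑ x ∈ Fintype.piFinset (fun _ : Fin n => s), ‖F (fun i => a • siteToE (x i))‖ ≤
      2 ^ (6 * n) * (Finset.Iic (6 * n, 0)).sup (fun m => SchwartzMap.seminorm ℂ m.1 m.2) F *
        (81 * ∑' m : ℕ, (((m : ℝ) + 1) ^ 2)⁻¹) ^ n := by
  rw [Finset.mul_sum]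
  calc ∑ x ∈ Fintype.piFinset (fun _ : Fin n => s), a ^ (4 * n) * ‖F (fun i => a • siteToE (x i))‖
      ≤ ∑ x ∈ Fintype.piFinset (fun _ : Fin n => s),
          2 ^ (6 * n) * (Finset.Iic (6 * n, 0)).sup (fun m => SchwartzMap.seminorm ℂ m.1 m.2) F *
            ∏ i, (a ^ 4 * ((1 + a * ‖x i‖) ^ 6)⁻¹) := Finset.sum_le_sum fun x _ => pow_mul_norm_apply_le F ha x
    _ = 2 ^ (6 * n) * (Finset.Iic (6 * n, 0)).sup (fun m => SchwartzMap.seminorm ℂ m.1 m.2) F *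
          ∑ x ∈ Fintype.piFinset (fun _ : Fin n => s), ∏ i, (a ^ 4 * ((1 + a * ‖x i‖) ^ 6)⁻¹) := by
        rw [Finset.mul_sum]
    _ ≤ _ := mul_le_mul_of_nonneg_left (sum_prod_decay_le ha ha1 le_rfl s n)
          (mul_nonneg (by positivity) (apply_nonneg _ _))

/-! ## §2 ★ The two-point recentring difference is driven by `a⁻⁴·(m_C − m)` -/

section TwoPoint

variable {G : Type*} [Group G] {N : ℕ} (ρ : G →* Matrix (Fin N) (Fin N) ℂ)
  [TopologicalSpace G] [IsTopologicalGroup G] [CompactSpace G] [MeasurableSpace G] [BorelSpace G]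

/-- Norm bound for the two-point recentring difference at one lattice: for `0 < a ≤ 1`,
`‖dist_C(a·; m_C) F − dist_C(a·; m) F‖ ≤ (a⁻⁴(m_C − m))² · 2¹²·S_{(12,0)}(F)·K²`. [folklore] -/
theorem norm_dist_two_sub_dist_two_le (C : PeriodCell 4) (hρ : Continuous ρ) (β : ℝ) {O : LGConfig 4 G → ℝ}
    (hO : Measurable O) {B : ℝ} (hB : ∀ V, |O V| ≤ B) (m : ℝ) {a : ℝ} (ha : 0 < a) (ha1 : a ≤ 1)
    (F : 𝓢((Fin 2 → (EuclideanSpace ℝ (Fin 4))), ℂ)) :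
    ‖C.dist ρ β (fun z => a • siteToE z) O (C.mean ρ β O) 2 F - C.dist ρ β (fun z => a • siteToE z) O m 2 F‖ ≤
      ((a⁻¹) ^ 4 * (C.mean ρ β O - m)) ^ 2 *
        (2 ^ (6 * 2) * (Finset.Iic (6 * 2, 0)).sup (fun m => SchwartzMap.seminorm ℂ m.1 m.2) F *
          (81 * ∑' m : ℕ, (((m : ℝ) + 1) ^ 2)⁻¹) ^ 2) := by
  rw [dist_two_sub_dist_two C ρ hρ β (fun z => a • siteToE z) hO hB m F, norm_neg, norm_mul, Complex.norm_real,
    Real.norm_of_nonneg (sq_nonneg _)]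
  have hsum : ‖∑ x ∈ Fintype.piFinset (fun _ : Fin 2 => C.reps), F (fun i => a • siteToE (x i))‖ ≤
      ∑ x ∈ Fintype.piFinset (fun _ : Fin 2 => C.reps), ‖F (fun i => a • siteToE (x i))‖ := norm_sum_le _ _
  have hkey := pow_mul_sum_norm_le F ha ha1 C.reps (n := 2)
  have ha8 : (C.mean ρ β O - m) ^ 2 = ((a⁻¹) ^ 4 * (C.mean ρ β O - m)) ^ 2 * a ^ (4 * 2) := by
    have : a ≠ 0 := ha.ne'
    field_simp
  rw [ha8, mul_assoc]
  refine mul_le_mul_of_nonneg_left (le_trans (mul_le_mul_of_nonneg_left hsum (by positivity)) hkey) (sq_nonneg _)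

/-- ★ **`n = 2` recentring from the mean shift.**  For any cells `C_k` of `ℤ⁴`, spacings `a_k > 0` with `a_k → 0`, couplings `β_k`,
a bounded measurable observable `O` and comparison centrings `m_k`: if `a_k⁻⁴·(m_{C_k}(O) − m_k) → 0` then for EVERY Schwartz `F` on
`(ℝ⁴)²`, `dist_{C_k}(a_k·; m_{C_k}) F − dist_{C_k}(a_k·; m_k) F → 0`. [folklore] -/
theorem tendsto_dist_two_recentre_of_meanShift (C : ℕ → PeriodCell 4) (hρ : Continuous ρ) (a β m : ℕ → ℝ)
    (ha : ∀ k, 0 < a k) (ha0 : Tendsto a atTop (𝓝 0)) {O : LGConfig 4 G → ℝ} (hO : Measurable O) {B : ℝ}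
    (hB : ∀ V, |O V| ≤ B)
    (hΔ : Tendsto (fun k => (a k)⁻¹ ^ 4 * ((C k).mean ρ (β k) O - m k)) atTop (𝓝 0))
    (F : 𝓢((Fin 2 → (EuclideanSpace ℝ (Fin 4))), ℂ)) :
    Tendsto (fun k => (C k).dist ρ (β k) (fun z => a k • siteToE z) O ((C k).mean ρ (β k) O) 2 F -
      (C k).dist ρ (β k) (fun z => a k • siteToE z) O (m k) 2 F) atTop (𝓝 0) := by
  set K : ℝ := 2 ^ (6 * 2) * (Finset.Iic (6 * 2, 0)).sup (fun m => SchwartzMap.seminorm ℂ m.1 m.2) F *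
    (81 * ∑' m : ℕ, (((m : ℝ) + 1) ^ 2)⁻¹) ^ 2 with hK
  have ha1 : ∀ᶠ k in atTop, a k ≤ 1 := (tendsto_order.1 ha0).2 1 one_pos |>.mono fun k hk => hk.le
  refine squeeze_zero_norm' (a := fun k => ((a k)⁻¹ ^ 4 * ((C k).mean ρ (β k) O - m k)) ^ 2 * K) ?_ ?_
  · filter_upwards [ha1] with k hk
    exact norm_dist_two_sub_dist_two_le ρ (C k) hρ (β k) hO hB (m k) (ha k) hk F
  · have h := (hΔ.pow 2).mul_const K
    rwa [zero_pow two_ne_zero, zero_mul] at h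

end TwoPoint

/-! ## §3 ★ In the binders of the route: the `n = 2` clause of `CoverRecentring` from `MeanShiftSubQuartic` -/

/-- ★ **`CoverRecentring`, `n = 2`, from `MeanShiftSubQuartic`.**  For a compact group `G` with a lattice representation `r`, ANY
species scheme `sch` and ANY cells `C_k`: if the cover-minus-torus mean of the curvature species is `o(a_k⁴)`,
`a_k⁻⁴·(m_{C_k} − wilsonTorusMean(β_k, L_k)) → 0`, then for every Schwartz `F` on `(ℝ⁴)²`
`dist_{C_k}(a_k·; own mean) F − dist_{C_k}(a_k·; torus mean) F → 0` — the `n = 2` clause of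
`Theses.RecentredCoverTransfer.CoverRecentring` (there restricted to off-diagonal compactly supported `F`, and with the checkerboard /
`MomentBounds6` / leg-scheme binders, none of which is used). [folklore] -/
theorem coverRecentring_two_of_meanShiftSubQuartic {G : Type} [Group G] [TopologicalSpace G] [IsTopologicalGroup G]
    [CompactSpace G] [MeasurableSpace G] [BorelSpace G] (r : LatticeRep G) (sch : SpeciesScheme (YMSpecies G))
    (C : ℕ → PeriodCell 4)
    (hΔ : Tendsto (fun k => (sch.a k)⁻¹ ^ 4 *
      ((C k).mean r.ρ (sch.β k) r.curvature.F - wilsonTorusMean r.ρ (sch.β k) (sch.L k) r.curvature.F)) atTop (𝓝 0))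
    (F : 𝓢((Fin 2 → (EuclideanSpace ℝ (Fin 4))), ℂ)) :
    Tendsto (fun k => (C k).dist r.ρ (sch.β k) (fun z => (sch.a k) • siteToE z) r.curvature.F
        ((C k).mean r.ρ (sch.β k) r.curvature.F) 2 F -
      (C k).dist r.ρ (sch.β k) (fun z => (sch.a k) • siteToE z) r.curvature.F
        (wilsonTorusMean r.ρ (sch.β k) (sch.L k) r.curvature.F) 2 F) atTop (𝓝 0) := by
  obtain ⟨B, hB⟩ := r.curvature.bounded
  exact tendsto_dist_two_recentre_of_meanShift r.ρ C r.continuous sch.a sch.β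
    (fun k => wilsonTorusMean r.ρ (sch.β k) (sch.L k) r.curvature.F) sch.a_pos sch.tendsto_a r.curvature.measurable hB hΔ F

end Summit.QuantumFields.YangMills.Theorems.RecentredCoverTransfer

end
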